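import Summits.QuantumFields.YangMills.Theses.ParabolicTrajectory

/-!
# `BalabanStepParabolic` — negative-side support III: the orbit recursion (the covariance axiom (4a) is free)

Support file for crux `stmt-QuantumFields-9684` (`ParabolicTrajectory.BalabanStepParabolic`), extracted from the
standing disprover's work file `Cruxes/BalabanStepParabolic/Disproof.lean` §F1 (cycle 2). Tree objects only.

`orbitRec M F T e` (+ `orbitRec_mul`, `orbitRec_pow_mul`, `continuous_orbitRec`): peeling factors `M` off the
torus size turns ANY germ `e` into a functional `X` with `X (F p) S a = X p (M S) (D a)` whenever `T ∘ D = id`;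
with `T = contractTuple M` (componentwise `blockContract M`, the inverse of `blockDilate M`, proved here:
`blockDilate_blockContract`, `blockContract_blockDilate` and their iterates) this is EXACTLY the covariance axiom
(4a) `expect_step` of `BalabanBanachStep`, which therefore has no content of its own (structural finding F1 of
`Cruxes/BalabanStepParabolic/Ideas/structuralfindings.md`, mechanised). It is also the natural way for a prover
to BUILD `expect` from data on base tori; `continuous_orbitRec` transfers continuity of the germ.
-/

namespace Summit.QuantumFields.YangMills.Theorems.BalabanStepParabolic.Negative

open scoped SchwartzMap
open MeasureTheory Filter Topology
open Literature.MathematicalPhysics.QuantumFieldTheory Literature.MathematicalPhysics.AQFT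
open Literature.MathematicalPhysics.QuantumLattice

noncomputable section

/-! ### F1: the base-torus recursion that makes (4a) hold identically -/

section OrbitRec

variable {P α β : Type} (M : ℕ) (F : P → P) (T : α → α) (e : P → ℕ → α → β)

/-- **Orbit recursion** (structural finding F1 of `Ideas/structuralfindings.md`, recast as a
well-founded recursion on the torus size): given ANY germ `e p S a` and a step `F` on chart points,
a pull-back `T` on test data, define `orbitRec p S a` by peeling factors `M` off `S`:
`orbitRec p (M·S) a = orbitRec (F p) S (T a)` and `orbitRec p S a = e p S a` when `M ∤ S` or `S = 0`.
With `T` a left inverse of block dilation this makes the covariance axiom (4a) of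
`BalabanBanachStep` hold IDENTICALLY, for every germ. [folklore] -/
def orbitRec (hM : 2 ≤ M) : P → ℕ → α → β
  | p, S, a =>
    if _h : S ≠ 0 ∧ M ∣ S then orbitRec hM (F p) (S / M) (T a) else e p S a
  termination_by _ S _ => S
  decreasing_by exact Nat.div_lt_self (Nat.pos_of_ne_zero _h.1) (by omega)

variable {M} (hM : 2 ≤ M)

/-- Base case of the recursion: no factor `M` to peel. [folklore] -/
theorem orbitRec_of_not (p : P) (S : ℕ) (a : α) (h : ¬ (S ≠ 0 ∧ M ∣ S)) :
    orbitRec M F T e hM p S a = e p S a := by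
  rw [orbitRec]; simp [h]

/-- The recursion at torus size `0` is the germ. [folklore] -/
theorem orbitRec_zero (p : P) (a : α) : orbitRec M F T e hM p 0 a = e p 0 a :=
  orbitRec_of_not F T e hM p 0 a (by simp)

/-- One peeled factor: `orbitRec p (M S) a = orbitRec (F p) S (T a)`. [folklore] -/
theorem orbitRec_mul (p : P) {S : ℕ} (hS : S ≠ 0) (a : α) :
    orbitRec M F T e hM p (M * S) a = orbitRec M F T e hM (F p) S (T a) := by
  have hM0 : M ≠ 0 := by omega
  have h : M * S ≠ 0 ∧ M ∣ M * S := ⟨Nat.mul_ne_zero hM0 hS, dvd_mul_right M S⟩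
  rw [orbitRec, dif_pos h, Nat.mul_div_cancel_left S (by omega)]

/-- Full unfolding along `k` peeled factors. [folklore] -/
theorem orbitRec_pow_mul (p : P) {S : ℕ} (hS : S ≠ 0) (a : α) (k : ℕ) :
    orbitRec M F T e hM p (M ^ k * S) a = orbitRec M F T e hM (F^[k] p) S (T^[k] a) := by
  induction k generalizing p a with
  | zero => simp
  | succ k ih =>
    have hM0 : M ≠ 0 := by omega
    rw [pow_succ', mul_assoc, orbitRec_mul F T e hM p (Nat.mul_ne_zero (pow_ne_zero k hM0) hS),
      ih (F p) (T a)]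
    simp only [Function.iterate_succ_apply]

/-- Continuity is inherited from the germ through the recursion. [folklore] -/
theorem continuous_orbitRec [TopologicalSpace P] [TopologicalSpace β] (hF : Continuous F)
    (he : ∀ S a, Continuous fun p => e p S a) (S : ℕ) (a : α) :
    Continuous fun p => orbitRec M F T e hM p S a := by
  induction S using Nat.strong_induction_on generalizing a with
  | _ S ih =>
    by_cases h : S ≠ 0 ∧ M ∣ S
    · obtain ⟨S', rfl⟩ := h.2
      have hS' : S' ≠ 0 := by rintro rfl; exact h.1 (by simp)
      have hlt : S' < M * S' := by
        have : 1 * S' < M * S' := Nat.mul_lt_mul_of_pos_right (by omega) (Nat.pos_of_ne_zero hS')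
        simpa using this
      simp_rw [orbitRec_mul F T e hM _ hS']
      exact (ih S' hlt (T a)).comp hF
    · simp_rw [orbitRec_of_not F T e hM _ S _ h]
      exact he S a

end OrbitRec

/-! ### Block contraction: the inverse of `blockDilate` -/

/-- `blockContract M f = f ∘ (M • ·)`, the inverse of `blockDilate M` for `M ≠ 0`
(junk: identity at `M = 0`). [folklore] -/
def blockContract (M : ℕ) :
    𝓢(EuclideanSpace ℝ (Fin 4), ℝ) →L[ℝ] 𝓢(EuclideanSpace ℝ (Fin 4), ℝ) :=
  if hM : M = 0 then ContinuousLinearMap.id ℝ _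
  else
    SchwartzMap.compCLMOfContinuousLinearEquiv ℝ
      ((LinearEquiv.smulOfNeZero ℝ (EuclideanSpace ℝ (Fin 4)) (M : ℝ)
          (Nat.cast_ne_zero.2 hM)).toContinuousLinearEquiv)

/-- `(blockContract M f) x = f (M • x)` for `M ≠ 0`. [folklore] -/
@[simp] theorem blockContract_apply {M : ℕ} (hM : M ≠ 0) (f : 𝓢(EuclideanSpace ℝ (Fin 4), ℝ))
    (x : EuclideanSpace ℝ (Fin 4)) : blockContract M f x = f ((M : ℝ) • x) := by
  simp only [blockContract, hM, ↓reduceDIte, SchwartzMap.compCLMOfContinuousLinearEquiv_apply,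
    Function.comp_apply, LinearEquiv.coe_toContinuousLinearEquiv', LinearEquiv.smulOfNeZero_apply]

/-- `blockDilate M ∘ blockContract M = id` (`M ≠ 0`). [folklore] -/
theorem blockDilate_blockContract {M : ℕ} (hM : M ≠ 0) (f : 𝓢(EuclideanSpace ℝ (Fin 4), ℝ)) :
    blockDilate M (blockContract M f) = f := by
  ext x
  have hM' : (M : ℝ) ≠ 0 := Nat.cast_ne_zero.2 hM
  rw [blockDilate_apply hM, blockContract_apply hM, smul_smul, mul_inv_cancel₀ hM', one_smul]

/-- `blockContract M ∘ blockDilate M = id` (`M ≠ 0`). [folklore] -/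
theorem blockContract_blockDilate {M : ℕ} (hM : M ≠ 0) (f : 𝓢(EuclideanSpace ℝ (Fin 4), ℝ)) :
    blockContract M (blockDilate M f) = f := by
  ext x
  have hM' : (M : ℝ) ≠ 0 := Nat.cast_ne_zero.2 hM
  rw [blockContract_apply hM, blockDilate_apply hM, smul_smul, inv_mul_cancel₀ hM', one_smul]

/-- Iterated dilation undoes iterated contraction. [folklore] -/
theorem blockDilate_iterate_blockContract_iterate {M : ℕ} (hM : M ≠ 0) (k : ℕ)
    (f : 𝓢(EuclideanSpace ℝ (Fin 4), ℝ)) :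
    (blockDilate M)^[k] ((blockContract M)^[k] f) = f := by
  induction k generalizing f with
  | zero => rfl
  | succ k ih =>
    rw [Function.iterate_succ_apply', Function.iterate_succ_apply, ih,
      blockDilate_blockContract hM]

/-- Pull-back of a tuple of test functions by block contraction. [folklore] -/
def contractTuple (M : ℕ) {n : ℕ} (f : Fin n → 𝓢(EuclideanSpace ℝ (Fin 4), ℝ)) :
    Fin n → 𝓢(EuclideanSpace ℝ (Fin 4), ℝ) := fun i => blockContract M (f i)

/-- Contracting a dilated tuple gives it back. [folklore] -/
@[simp] theorem contractTuple_dilate {M : ℕ} (hM : M ≠ 0) {n : ℕ}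
    (f : Fin n → 𝓢(EuclideanSpace ℝ (Fin 4), ℝ)) :
    contractTuple M (fun i => blockDilate M (f i)) = f := by
  funext i; simp [contractTuple, blockContract_blockDilate hM]

/-- Iterated tuple contraction is componentwise. [folklore] -/
theorem contractTuple_iterate (M : ℕ) {n : ℕ} (k : ℕ)
    (f : Fin n → 𝓢(EuclideanSpace ℝ (Fin 4), ℝ)) :
    (contractTuple M)^[k] f = fun i => (blockContract M)^[k] (f i) := by
  induction k generalizing f with
  | zero => rfl
  | succ k ih =>
    rw [Function.iterate_succ_apply, ih]
    funext i
    rw [Function.iterate_succ_apply]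
    rfl

/-- Iterated dilation undoes iterated tuple contraction. [folklore] -/
theorem dilate_iterate_contractTuple_iterate {M : ℕ} (hM : M ≠ 0) {n : ℕ} (k : ℕ)
    (f : Fin n → 𝓢(EuclideanSpace ℝ (Fin 4), ℝ)) :
    (fun i => (blockDilate M)^[k] (((contractTuple M)^[k] f) i)) = f := by
  rw [contractTuple_iterate]
  funext i
  exact blockDilate_iterate_blockContract_iterate hM k (f i)


end

end Summit.QuantumFields.YangMills.Theorems.BalabanStepParabolic.Negative
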